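/-
Copyright (c) 2026. Released under Apache 2.0 license.
-/
import Literature.NumberTheory.Automorphic.UnboundedDenominatorsInvariantHomLocalCyclic
import Literature.NumberTheory.Automorphic.UnboundedDenominatorsLayerCoordinates
import Literature.NumberTheory.Automorphic.UnboundedDenominatorsCyclicOverAbelian
import HarnessLib

/-!
# The invariant form of CDT Cor. 4.5.3: the local certificate at a block `p²` (`p` odd)

The `p`-adic core of the invariant form of [CalegariDimitrovTang2025, Corollary 4.5.3] at the first
non-trivial depth: for an odd prime `p`, `gcd(m', p) = 1`, and an `SL₂(ℤ)`-conjugation-invariant homomorphism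
`θ : Γ(m'p²) → Q` of `p`-power exponent, `θ` satisfies the local condition for `Γ(m')`
(`local_Gamma_prime_sq`): it kills `Γ(m'p²) ∩ ([Γ(m'), Γ(m')] · K_θ)`.  Equivalently: in the central extension
`G = SL₂(ℤ)/K_θ` of `SL₂(ℤ/p²)`-block type realised by `SL₂(ℤ)`, the centre coming from `Γ(m'p²)` meets the
commutator subgroup of the preimage of `SL₂(ℤ/p²)` trivially — the vanishing of the Schur multiplier of
`SL₂(ℤ/p²)` at `p` for odd `p` [Beyl1986], proved here by an elementary layer argument:

1. (`V̂` abelian) the image of `A = Γ(m'p)` in `G` is abelian: the commutator pairing on the layer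
   `A/Γ(m'p²) ≅ 𝔰𝔩₂(𝔽_p)` is an `SL₂(ℤ)`-invariant alternating pairing into the centre; it dies on `e = t^p`
   (class `E`) against `f' = S e S⁻¹` by the `S`-symmetry (`S² = -1`, values of odd order) and against
   `h' = T f' T⁻¹`, hence everywhere by the normal form of the layer;
2. (Sylow) for the preimage `L = ⟨t̂⟩ · Â` of the Sylow `p`-subgroup `⟨T̄⟩ ⋉ V`, `[L, L] = {t̂ â t̂⁻¹ â⁻¹}` and
   such an element is central only if `â ∈ ⟨ê⟩ Z` (the centraliser of `T̄` in `𝔰𝔩₂(𝔽_p)` is `𝔽_p E` for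
   odd `p`), where it is trivial since `t` commutes with `e = t^p`;
3. transfer from `L` (index `p² - 1` in the `Γ(m')`-block) to `Γ(m')`.

[cite: CalegariDimitrovTang2025, Corollary 4.5.3] [cite: Beyl1986, Theorem]
-/

open scoped MatrixGroups commutatorElement

namespace Literature.NumberTheory.Automorphic

namespace UnboundedDenominators

open CongruenceSubgroup Matrix.SpecialLinearGroup ModularGroup
open Literature.NumberTheory.EllipticCurves.ModularForms (index_Gamma_eq_card index_Gamma_eq_mul)

variable {Q : Type*} [CommGroup Q]

/-- `Γ(L) ≤ Γ(M)` for `M ∣ L`. [folklore] -/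
private theorem Gamma_le_Gamma_of_dvd₇ {M L : ℕ} (h : M ∣ L) : Gamma L ≤ Gamma M := by
  intro γ hγ
  obtain ⟨h00, h01, h10, h11⟩ := Gamma_mem.mp hγ
  have cast_eq : ∀ a : ℤ, ((a : ZMod L).cast : ZMod M) = (a : ZMod M) := fun a ↦
    ZMod.cast_intCast h a
  rw [Gamma_mem]
  refine ⟨?_, ?_, ?_, ?_⟩
  · rw [← cast_eq, h00, ZMod.cast_one h]
  · rw [← cast_eq, h01, ZMod.cast_zero]
  · rw [← cast_eq, h10, ZMod.cast_zero]
  · rw [← cast_eq, h11, ZMod.cast_one h]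

/-- `S² = -1` is central in `SL₂(ℤ)`. [folklore] -/
private theorem S_mul_S_comm (g : SL(2, ℤ)) : S * S * g = g * (S * S) := by
  have hS2 : (S : Matrix (Fin 2) (Fin 2) ℤ) * (S : Matrix (Fin 2) (Fin 2) ℤ) = -1 := by
    rw [coe_S]
    ext i j
    fin_cases i <;> fin_cases j <;> simp [Matrix.mul_apply, Fin.sum_univ_two]
  apply Subtype.ext
  simp only [Matrix.SpecialLinearGroup.coe_mul]
  rw [hS2, neg_one_mul, mul_neg_one]

/-- `[SL₂(𝔽_p) : ⟨T̄⟩] = (p+1)(p-1)`. [cite: DiamondShurman2005, §1.2 and Exercise 1.2.3] -/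
theorem index_zpowers_map_T {p : ℕ} (hp : p.Prime) :
    (Subgroup.zpowers (Matrix.SpecialLinearGroup.map (Int.castRingHom (ZMod p)) T)).index =
      (p + 1) * (p - 1) := by
  haveI : Fact p.Prime := ⟨hp⟩
  haveI : NeZero p := ⟨hp.ne_zero⟩
  set tbar : SL(2, ZMod p) := Matrix.SpecialLinearGroup.map (Int.castRingHom (ZMod p)) T with ht
  have hord : orderOf tbar = p := by
    refine orderOf_eq_prime ?_ ?_
    · rw [ht, ← map_pow]
      have : (T : SL(2, ℤ)) ^ (p : ℤ) ∈ Gamma p := by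
        simpa using ModularGroup_T_pow_mem_Gamma (p : ℤ) (p : ℤ) (dvd_refl _)
      rw [zpow_natCast] at this
      exact Gamma_mem'.mp this
    · intro h
      have h01 := congrArg (fun A : SL(2, ZMod p) ↦ A 0 1) h
      simp [ht, coe_T] at h01
  have hcard : Nat.card SL(2, ZMod p) = p * ((p + 1) * (p - 1)) := by
    rw [← index_Gamma_eq_card, index_Gamma_eq_mul, index_Gamma1_prime hp]
  have h := (Subgroup.zpowers tbar).index_mul_card
  rw [Nat.card_zpowers, hord, hcard, mul_comm p] at h
  exact Nat.eq_of_mul_eq_mul_right hp.pos h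

/-- **The local certificate at a block `p²`, `p` odd.**  Let `p` be an odd prime, `gcd(m', p) = 1`,
`θ : Γ(m'p²) → Q` an `SL₂(ℤ)`-conjugation-invariant homomorphism with `θ(x)^{p^a} = 1`.  Then `θ` is trivial
on `Γ(m'p²) ∩ ([Γ(m'), Γ(m')] · K_θ)`.  (The Schur multiplier of `SL₂(ℤ/p²)` has no `p`-part for odd `p`.)
[cite: CalegariDimitrovTang2025, Corollary 4.5.3] [cite: Beyl1986, Theorem] -/
theorem local_Gamma_prime_sq {p m' a : ℕ} (hp : p.Prime) (hp2 : p ≠ 2) [NeZero m'] (hmm : m'.Coprime p)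
    (θ : Gamma (m' * p ^ 2) →* Q)
    (hθ : ∀ (g x : SL(2, ℤ)) (hx : x ∈ Gamma (m' * p ^ 2)) (hgx : g * x * g⁻¹ ∈ Gamma (m' * p ^ 2)),
      θ ⟨g * x * g⁻¹, hgx⟩ = θ ⟨x, hx⟩)
    (he : ∀ x : Gamma (m' * p ^ 2), θ x ^ (p ^ a) = 1) :
    ∀ (y : SL(2, ℤ)) (hy : y ∈ Gamma (m' * p ^ 2)),
      y ∈ ⁅Gamma m', Gamma m'⁆ ⊔ θ.ker.map (Gamma (m' * p ^ 2)).subtype → θ ⟨y, hy⟩ = 1 := by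
  classical
  haveI : Fact p.Prime := ⟨hp⟩
  haveI : NeZero p := ⟨hp.ne_zero⟩
  haveI : NeZero (p ^ 2) := ⟨pow_ne_zero 2 hp.ne_zero⟩
  haveI := ker_map_subtype_normal θ hθ
  haveI := Gamma_normal (m' * p ^ 2)
  haveI := Gamma_normal (m' * p)
  haveI := Gamma_normal m'
  haveI := Gamma_normal (p ^ 2)
  have hmm2 : m'.Coprime (p ^ 2) := Nat.Coprime.pow_right 2 hmm
  set red := Matrix.SpecialLinearGroup.map (n := Fin 2) (Int.castRingHom (ZMod p)) with hred
  set red2 := Matrix.SpecialLinearGroup.map (n := Fin 2) (Int.castRingHom (ZMod (p ^ 2))) with hred2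
  set K : Subgroup SL(2, ℤ) := θ.ker.map (Gamma (m' * p ^ 2)).subtype with hKdef
  set π : SL(2, ℤ) →* SL(2, ℤ) ⧸ K := QuotientGroup.mk' K with hπ
  set Z : Subgroup (SL(2, ℤ) ⧸ K) := (Gamma (m' * p ^ 2)).map π with hZ
  set Ahat : Subgroup (SL(2, ℤ) ⧸ K) := (Gamma (m' * p)).map π with hAhat
  -- inclusions between the congruence subgroups involved
  have hNA : Gamma (m' * p ^ 2) ≤ Gamma (m' * p) := Gamma_le_Gamma_of_dvd₇ ⟨p, by ring⟩
  have hAm' : Gamma (m' * p) ≤ Gamma m' := Gamma_le_Gamma_of_dvd₇ (dvd_mul_right m' p)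
  have hAp : Gamma (m' * p) ≤ Gamma p := Gamma_le_Gamma_of_dvd₇ (dvd_mul_left p m')
  have hNm' : Gamma (m' * p ^ 2) ≤ Gamma m' := Gamma_le_Gamma_of_dvd₇ (dvd_mul_right m' (p ^ 2))
  have hNp2 : Gamma (m' * p ^ 2) ≤ Gamma (p ^ 2) := Gamma_le_Gamma_of_dvd₇ (dvd_mul_left (p ^ 2) m')
  have hp2p : Gamma (p ^ 2) ≤ Gamma p := Gamma_le_Gamma_of_dvd₇ (dvd_pow_self p two_ne_zero)
  have hmemN : ∀ x : SL(2, ℤ), x ∈ Gamma m' → x ∈ Gamma (p ^ 2) → x ∈ Gamma (m' * p ^ 2) :=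
    fun x h1 h2 ↦ mem_Gamma_mul_of_coprime hmm2 h1 h2
  have hmemA : ∀ x : SL(2, ℤ), x ∈ Gamma m' → x ∈ Gamma p → x ∈ Gamma (m' * p) :=
    fun x h1 h2 ↦ mem_Gamma_mul_of_coprime hmm h1 h2
  -- the lift `t` of `T mod p²` inside `Γ(m')`, and `e = t^p`, `f' = S e S⁻¹`, `h' = T f' T⁻¹`
  obtain ⟨t, htm', ht⟩ := exists_mem_Gamma_map_eq hmm2 (red2 T)
  have hτ : T⁻¹ * t ∈ Gamma (p ^ 2) := by
    rw [Gamma_mem', map_mul, map_inv, ← hred2, ht, inv_mul_cancel]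
  have htp : red t = red T := by
    have h := Gamma_mem'.mp (hp2p hτ)
    rw [map_mul, map_inv, ← hred, inv_mul_eq_one] at h
    exact h.symm
  have hTp : T ^ p ∈ Gamma p := by
    have := ModularGroup_T_pow_mem_Gamma (p : ℤ) (p : ℤ) (dvd_refl _)
    rwa [zpow_natCast, Int.natAbs_natCast] at this
  set e : SL(2, ℤ) := t ^ p with he_def
  have he_m' : e ∈ Gamma m' := pow_mem htm' p
  have heT : e * (T ^ p)⁻¹ ∈ Gamma (p ^ 2) := by
    rw [Gamma_mem', map_mul, map_inv, he_def, map_pow, ← hred2, ht, ← map_pow, mul_inv_cancel]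
  have he_p : e ∈ Gamma p := by
    have h := mul_mem (hp2p heT) hTp
    rwa [inv_mul_cancel_right] at h
  have he_A : e ∈ Gamma (m' * p) := hmemA e he_m' he_p
  set f' : SL(2, ℤ) := S * e * S⁻¹ with hf'_def
  have hf'_A : f' ∈ Gamma (m' * p) := (Gamma_normal (m' * p)).conj_mem e he_A S
  set h' : SL(2, ℤ) := T * f' * T⁻¹ with hh'_def
  have hh'_A : h' ∈ Gamma (m' * p) := (Gamma_normal (m' * p)).conj_mem f' hf'_A T
  -- layer coordinates
  obtain ⟨Φ, P1, P2, P3, P4, P5, P6, P7⟩ := exists_layerCoord p hp.ne_zero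
  have hΦcongr : ∀ (u v : SL(2, ℤ)) (hu : u ∈ Gamma p) (hv : v ∈ Gamma p), u * v⁻¹ ∈ Gamma (p ^ 2) →
      Φ ⟨u, hu⟩ = Φ ⟨v, hv⟩ := by
    intro u v hu hv huv
    have h1 := P2 (u * v⁻¹) (mul_mem hu (inv_mem hv)) huv
    have h2 : (⟨u * v⁻¹, mul_mem hu (inv_mem hv)⟩ : Gamma p) = ⟨u, hu⟩ * ⟨v, hv⟩⁻¹ := rfl
    rw [h2, map_mul, map_inv, mul_inv_eq_one] at h1
    exact h1
  have hΦe : Φ ⟨e, he_p⟩ = Multiplicative.ofAdd (0, 1, 0) := by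
    rw [hΦcongr e (T ^ p) he_p hTp heT]; exact P5 hTp
  have hSTp : S * T ^ p * S⁻¹ ∈ Gamma p := (Gamma_normal p).conj_mem _ hTp S
  have hΦf : Φ ⟨f', hAp hf'_A⟩ = Multiplicative.ofAdd (0, 0, -1) := by
    rw [hΦcongr f' (S * T ^ p * S⁻¹) (hAp hf'_A) hSTp]
    · exact P6 hSTp
    · rw [show f' * (S * T ^ p * S⁻¹)⁻¹ = S * (e * (T ^ p)⁻¹) * S⁻¹ by rw [hf'_def]; group]
      exact (Gamma_normal (p ^ 2)).conj_mem _ heT S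
  have hΦh : Φ ⟨h', hAp hh'_A⟩ = Multiplicative.ofAdd (-1, 1, -1) := by
    refine (P4 f' (hAp hf'_A) (hAp hh'_A) 0 0 (-1) hΦf).trans ?_
    congr 1
    norm_num
  -- normal form of the layer: `b = γ · h'^i e^j f'^k` with `γ ∈ Γ(m'p²)`
  have hgen : ∀ b ∈ Gamma (m' * p), ∃ (i j k : ℤ) (γ : SL(2, ℤ)), γ ∈ Gamma (m' * p ^ 2) ∧
      b = γ * (h' ^ i * e ^ j * f' ^ k) := by
    intro b hb
    obtain ⟨i, j, k, hijk⟩ := P7 h' e f' (hAp hh'_A) he_p (hAp hf'_A) hΦh hΦe hΦf b (hAp hb)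
    refine ⟨i, j, k, b * (h' ^ i * e ^ j * f' ^ k)⁻¹, hmemN _ ?_ hijk, by group⟩
    exact mul_mem (hAm' hb) (inv_mem (mul_mem (mul_mem (zpow_mem (hAm' hh'_A) i)
      (zpow_mem he_m' j)) (zpow_mem (hAm' hf'_A) k)))
  -- the quotient `G = SL₂(ℤ)/K_θ`
  have hπA : ∀ u ∈ Gamma (m' * p), π u ∈ Ahat := fun u hu ↦ Subgroup.mem_map_of_mem π hu
  have hZc : Z ≤ Subgroup.center (SL(2, ℤ) ⧸ K) := by
    rintro _ ⟨x, hx, rfl⟩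
    exact mk_mem_center_of_mem_Gamma θ hθ hx
  have hπone : ∀ (y : SL(2, ℤ)) (hy : y ∈ Gamma (m' * p ^ 2)), θ ⟨y, hy⟩ = 1 → π y = 1 := by
    intro y hy h
    rw [hπ, QuotientGroup.mk'_apply, QuotientGroup.eq_one_iff]
    exact (mem_ker_map_subtype_iff θ).mpr ⟨hy, h⟩
  have hπpow : ∀ y : SL(2, ℤ), y ∈ Gamma (m' * p ^ 2) → (π y) ^ (p ^ a) = 1 := by
    intro y hy
    rw [← map_pow]
    refine hπone _ (pow_mem hy _) ?_
    have h1 : (⟨y ^ p ^ a, pow_mem hy _⟩ : Gamma (m' * p ^ 2)) = ⟨y, hy⟩ ^ (p ^ a) := rfl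
    rw [h1, map_pow, he]
  have hZmem : ∀ y : SL(2, ℤ), π y ∈ Z → y ∈ Gamma (m' * p ^ 2) := by
    rintro y ⟨γ, hγ, hγy⟩
    rw [hπ, QuotientGroup.mk'_eq_mk'] at hγy
    obtain ⟨z, hz, hze⟩ := hγy
    rw [← hze]
    exact mul_mem hγ (ker_map_subtype_le θ hz)
  have hcentral : ∀ γ ∈ Gamma (m' * p ^ 2), ∀ w : SL(2, ℤ) ⧸ K, ⁅w, π γ⁆ = 1 ∧ ⁅π γ, w⁆ = 1 := by
    intro γ hγ w
    have hc := hZc (Subgroup.mem_map_of_mem π hγ)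
    rw [Subgroup.mem_center_iff] at hc
    constructor
    · rw [commutatorElement_def, hc w]; group
    · rw [commutatorElement_def, ← hc w]; group
  -- commutators of elements of `A` are central
  have hcommN : ∀ x ∈ Gamma (m' * p), ∀ y ∈ Gamma (m' * p), ⁅x, y⁆ ∈ Gamma (m' * p ^ 2) := fun x hx y hy ↦
    Gamma_le_Gamma_of_dvd₇ ⟨m', by ring⟩ (commutatorElement_mem_Gamma_mul_of_mem hx hy)
  have hcz : ∀ x ∈ Ahat, ∀ y ∈ Ahat, ⁅x, y⁆ ∈ Subgroup.center (SL(2, ℤ) ⧸ K) := by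
    rintro _ ⟨x, hx, rfl⟩ _ ⟨y, hy, rfl⟩
    rw [← map_commutatorElement]
    exact hZc (Subgroup.mem_map_of_mem π (hcommN x hx y hy))
  -- `y ↦ ⁅x, y⁆` is a homomorphism on `Â`
  have hF : ∀ x ∈ Ahat, ∃ F : Ahat →* SL(2, ℤ) ⧸ K, ∀ (u : SL(2, ℤ) ⧸ K) (hu : u ∈ Ahat), F ⟨u, hu⟩ = ⁅x, u⁆ := by
    intro x hx
    refine ⟨MonoidHom.mk' (fun y : Ahat ↦ ⁅x, (y : SL(2, ℤ) ⧸ K)⁆) ?_, fun u hu ↦ rfl⟩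
    intro y z
    have hc := hcz x hx z z.2
    rw [Subgroup.mem_center_iff] at hc
    calc ⁅x, ((y * z : Ahat) : SL(2, ℤ) ⧸ K)⁆
        = ⁅x, (y : SL(2, ℤ) ⧸ K)⁆ * ((y : SL(2, ℤ) ⧸ K) * ⁅x, (z : SL(2, ℤ) ⧸ K)⁆ * (y : SL(2, ℤ) ⧸ K)⁻¹) := by
          rw [Subgroup.coe_mul]; simp only [commutatorElement_def]; group
      _ = ⁅x, (y : SL(2, ℤ) ⧸ K)⁆ * ⁅x, (z : SL(2, ℤ) ⧸ K)⁆ := by rw [hc (y : SL(2, ℤ) ⧸ K), mul_inv_cancel_right]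
  -- if `x ∈ Â` commutes with `ê`, `f̂'`, `ĥ'` then with all of `Â`
  have hkill : ∀ x ∈ Ahat, ⁅x, π e⁆ = 1 → ⁅x, π f'⁆ = 1 → ⁅x, π h'⁆ = 1 →
      ∀ b ∈ Gamma (m' * p), ⁅x, π b⁆ = 1 := by
    intro x hx h1 h2 h3 b hb
    obtain ⟨F, hFapply⟩ := hF x hx
    obtain ⟨i, j, k, γ, hγ, hbeq⟩ := hgen b hb
    have key : (⟨π b, hπA b hb⟩ : Ahat) = ⟨π γ, hπA γ (hNA hγ)⟩ *
        (⟨π h', hπA h' hh'_A⟩ ^ i * ⟨π e, hπA e he_A⟩ ^ j * ⟨π f', hπA f' hf'_A⟩ ^ k) := by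
      apply Subtype.ext
      simp only [Subgroup.coe_mul, SubgroupClass.coe_zpow]
      rw [hbeq, map_mul, map_mul, map_mul, map_zpow, map_zpow, map_zpow]
    calc ⁅x, π b⁆ = F ⟨π b, hπA b hb⟩ := (hFapply _ _).symm
      _ = F ⟨π γ, hπA γ (hNA hγ)⟩ * (F ⟨π h', hπA h' hh'_A⟩ ^ i * F ⟨π e, hπA e he_A⟩ ^ j *
            F ⟨π f', hπA f' hf'_A⟩ ^ k) := by
          rw [key, map_mul, map_mul, map_mul, map_zpow, map_zpow, map_zpow]
      _ = 1 := by
          rw [hFapply, hFapply, hFapply, hFapply, (hcentral γ hγ x).1, h1, h2, h3, one_zpow, one_zpow,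
            one_zpow, mul_one, mul_one, mul_one]
  -- `S² = -1`: `S f' S⁻¹ = e`
  have hSfS : S * f' * S⁻¹ = e := by
    rw [hf'_def, show S * (S * e * S⁻¹) * S⁻¹ = (S * S) * e * (S * S)⁻¹ by group, S_mul_S_comm e,
      mul_inv_cancel_right]
  have hconjS : ∀ u v : SL(2, ℤ), π S * ⁅π u, π v⁆ * (π S)⁻¹ = ⁅π (S * u * S⁻¹), π (S * v * S⁻¹)⁆ := by
    intro u v; simp only [map_mul, map_inv, commutatorElement_def]; group
  -- `⁅ê, f̂'⁆ = 1` by the `S`-symmetry and oddness of `p`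
  have cop2 : Nat.Coprime 2 (p ^ a) :=
    Nat.Coprime.pow_right a ((Nat.coprime_primes Nat.prime_two hp).mpr hp2.symm)
  have hc0 : ⁅π e, π f'⁆ = 1 := by
    have hcent := hcz _ (hπA e he_A) _ (hπA f' hf'_A)
    rw [Subgroup.mem_center_iff] at hcent
    have h1 : π S * ⁅π e, π f'⁆ * (π S)⁻¹ = ⁅π e, π f'⁆⁻¹ := by
      rw [hconjS, hSfS, commutatorElement_inv, ← hf'_def]
    have h2 : π S * ⁅π e, π f'⁆ * (π S)⁻¹ = ⁅π e, π f'⁆ := by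
      rw [hcent (π S), mul_inv_cancel_right]
    have h3 : ⁅π e, π f'⁆⁻¹ = ⁅π e, π f'⁆ := h1.symm.trans h2
    have hsq : ⁅π e, π f'⁆ ^ 2 = 1 := by
      rw [pow_two]
      nth_rw 1 [← h3]
      exact inv_mul_cancel _
    have hpa : ⁅π e, π f'⁆ ^ (p ^ a) = 1 := by
      rw [← map_commutatorElement]
      exact hπpow _ (hcommN e he_A f' hf'_A)
    have h := pow_gcd_eq_one.mpr ⟨hsq, hpa⟩
    rwa [Nat.Coprime.gcd_eq_one cop2, pow_one] at h
  -- `γ₀ = T⁻¹ e T e⁻¹ ∈ Γ(N)`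
  have hγ₀ : T⁻¹ * e * T * e⁻¹ ∈ Gamma (m' * p ^ 2) := by
    refine hmemN _ (mul_mem ?_ (inv_mem he_m')) ?_
    · have h := (Gamma_normal m').conj_mem e he_m' T⁻¹
      rwa [inv_inv] at h
    · rw [Gamma_mem', map_mul, map_mul, map_mul, map_inv, map_inv, he_def, map_pow, ← hred2, ht, ← map_pow,
        ← map_inv, ← map_inv, ← map_mul, ← map_mul, ← map_mul]
      rw [show T⁻¹ * T ^ p * T * (T ^ p)⁻¹ = 1 by group, map_one]
  -- KEY: `ê` commutes with `Â`
  have hKEY : ∀ b ∈ Gamma (m' * p), ⁅π e, π b⁆ = 1 := by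
    refine hkill (π e) (hπA e he_A) (commutatorElement_self _) hc0 ?_
    have step : ⁅π e, π h'⁆ = π T * ⁅π (T⁻¹ * e * T), π f'⁆ * (π T)⁻¹ := by
      rw [hh'_def]; simp only [map_mul, map_inv, commutatorElement_def]; group
    rw [step, show T⁻¹ * e * T = (T⁻¹ * e * T * e⁻¹) * e by group, map_mul,
      show ⁅π (T⁻¹ * e * T * e⁻¹) * π e, π f'⁆ = π (T⁻¹ * e * T * e⁻¹) * ⁅π e, π f'⁆ * (π (T⁻¹ * e * T * e⁻¹))⁻¹ *
        ⁅π (T⁻¹ * e * T * e⁻¹), π f'⁆ by simp only [commutatorElement_def]; group,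
      hc0, (hcentral _ hγ₀ _).2, mul_one, mul_one, mul_inv_cancel, mul_one, mul_inv_cancel]
  have hFcase : ∀ x ∈ Gamma (m' * p), ⁅π x, π f'⁆ = 1 := by
    intro x hx
    have hxS : S⁻¹ * x * S ∈ Gamma (m' * p) := by
      simpa using (Gamma_normal (m' * p)).conj_mem x hx S⁻¹
    have h := hKEY _ hxS
    rw [← commutatorElement_inv, inv_eq_one] at h
    calc ⁅π x, π f'⁆ = π S * ⁅π (S⁻¹ * x * S), π e⁆ * (π S)⁻¹ := by
          rw [hf'_def]; simp only [map_mul, map_inv, commutatorElement_def]; group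
      _ = 1 := by rw [h, mul_one, mul_inv_cancel]
  have hHcase : ∀ x ∈ Gamma (m' * p), ⁅π x, π h'⁆ = 1 := by
    intro x hx
    have hxT : T⁻¹ * x * T ∈ Gamma (m' * p) := by
      simpa using (Gamma_normal (m' * p)).conj_mem x hx T⁻¹
    calc ⁅π x, π h'⁆ = π T * ⁅π (T⁻¹ * x * T), π f'⁆ * (π T)⁻¹ := by
          rw [hh'_def]; simp only [map_mul, map_inv, commutatorElement_def]; group
      _ = 1 := by rw [hFcase _ hxT, mul_one, mul_inv_cancel]
  -- STEP 1: `Â` is abelian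
  have hSTEP1 : ∀ x ∈ Gamma (m' * p), ∀ b ∈ Gamma (m' * p), ⁅π x, π b⁆ = 1 := by
    intro x hx
    refine hkill (π x) (hπA x hx) ?_ (hFcase x hx) (hHcase x hx)
    have h := hKEY x hx
    rwa [← commutatorElement_inv, inv_eq_one] at h
  have hAcomm : ∀ u ∈ Ahat, ∀ v ∈ Ahat, u * v = v * u := by
    rintro _ ⟨x, hx, rfl⟩ _ ⟨y, hy, rfl⟩
    exact commutatorElement_eq_one_iff_mul_comm.mp (hSTEP1 x hx y hy)
  -- STEP 2: the Sylow subgroup `⟨t̂⟩ · Â`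
  have htA : ∀ u ∈ Ahat, π t * u * (π t)⁻¹ ∈ Ahat := by
    rintro _ ⟨x, hx, rfl⟩
    rw [← map_mul, ← map_inv, ← map_mul]
    exact hπA _ ((Gamma_normal (m' * p)).conj_mem x hx t)
  have htA' : ∀ u ∈ Ahat, (π t)⁻¹ * u * π t ∈ Ahat := by
    rintro _ ⟨x, hx, rfl⟩
    rw [← map_inv, ← map_mul, ← map_mul]
    have h := (Gamma_normal (m' * p)).conj_mem x hx t⁻¹
    rw [inv_inv] at h
    exact hπA _ h
  have h2u : (2 : ZMod p) ≠ 0 := by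
    intro h0
    have h1 : (p : ℕ) ∣ 2 := (ZMod.natCast_eq_zero_iff 2 p).mp (by exact_mod_cast h0)
    exact hp2 ((Nat.prime_dvd_prime_iff_eq hp Nat.prime_two).mp h1)
  have hte : ∀ j : ℤ, t * e ^ j * t⁻¹ = e ^ j := by
    intro j
    have hc : Commute t (e ^ j) := (Commute.self_pow t p).zpow_right j
    rw [hc.eq, mul_inv_cancel_right]
  have hker : ∀ u ∈ Ahat, π t * u * (π t)⁻¹ * u⁻¹ ∈ Z → π t * u * (π t)⁻¹ * u⁻¹ = 1 := by
    rintro _ ⟨x, hx, rfl⟩ hz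
    have hz' : π ⁅t, x⁆ ∈ Z := by rw [map_commutatorElement, commutatorElement_def]; exact hz
    have htxN : ⁅t, x⁆ ∈ Gamma (m' * p ^ 2) := hZmem _ hz'
    obtain ⟨α, β, κ, hx3⟩ : ∃ α β κ : ZMod p, Φ ⟨x, hAp hx⟩ = Multiplicative.ofAdd (α, β, κ) :=
      ⟨(Multiplicative.toAdd (Φ ⟨x, hAp hx⟩)).1, (Multiplicative.toAdd (Φ ⟨x, hAp hx⟩)).2.1,
        (Multiplicative.toAdd (Φ ⟨x, hAp hx⟩)).2.2, by simp⟩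
    have hTx : T * x * T⁻¹ ∈ Gamma p := (Gamma_normal p).conj_mem x (hAp hx) T
    have htx : t * x * t⁻¹ ∈ Gamma p := (Gamma_normal p).conj_mem x (hAp hx) t
    have hΦtx : Φ ⟨t * x * t⁻¹, htx⟩ = Multiplicative.ofAdd (α + κ, β - 2 * α - κ, κ) := by
      rw [hΦcongr _ _ htx hTx ?_, P4 x (hAp hx) hTx α β κ hx3]
      rw [show t * x * t⁻¹ * (T * x * T⁻¹)⁻¹ = T * ⁅T⁻¹ * t, x⁆ * T⁻¹ by
        simp only [commutatorElement_def]; group]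
      refine (Gamma_normal (p ^ 2)).conj_mem _ ?_ T
      exact Gamma_le_Gamma_of_dvd₇ (dvd_mul_right (p ^ 2) (m' * p))
        (commutatorElement_mem_Gamma_mul_of_mem hτ hx)
    have h1 : Φ ⟨⁅t, x⁆, hp2p (hNp2 htxN)⟩ = 1 := P2 _ _ (hNp2 htxN)
    have h2 : (⟨⁅t, x⁆, hp2p (hNp2 htxN)⟩ : Gamma p) = ⟨t * x * t⁻¹, htx⟩ * ⟨x, hAp hx⟩⁻¹ :=
      Subtype.ext (by simp [commutatorElement_def])
    rw [h2, map_mul, map_inv, hΦtx, hx3, mul_inv_eq_one] at h1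
    have h3 := Multiplicative.ofAdd.injective h1
    simp only [Prod.mk.injEq] at h3
    obtain ⟨hακ, hβ', -⟩ := h3
    have hκ : κ = 0 := by linear_combination hακ
    have hα : α = 0 := by
      have h4 : (2 : ZMod p) * α = 0 := by linear_combination -hκ - hβ'
      rcases mul_eq_zero.mp h4 with h | h
      · exact absurd h h2u
      · exact h
    subst hκ hα
    -- `x = γ₁ · e^j`
    set j : ℤ := ((β.val : ℕ) : ℤ) with hj
    have hΦej : Φ (⟨e, he_p⟩ ^ j) = Multiplicative.ofAdd (0, β, 0) := by
      rw [map_zpow, hΦe]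
      apply Multiplicative.toAdd.injective
      simp only [toAdd_zpow, toAdd_ofAdd, Prod.smul_mk, smul_zero, hj, natCast_zsmul, nsmul_eq_mul, mul_one,
        ZMod.natCast_zmod_val]
    have hγ₁ : x * (e ^ j)⁻¹ ∈ Gamma (m' * p ^ 2) := by
      refine hmemN _ (mul_mem (hAm' hx) (inv_mem (zpow_mem he_m' j))) ?_
      refine P3 _ (mul_mem (hAp hx) (inv_mem (zpow_mem he_p j))) ?_
      have h5 : (⟨x * (e ^ j)⁻¹, mul_mem (hAp hx) (inv_mem (zpow_mem he_p j))⟩ : Gamma p) =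
          ⟨x, hAp hx⟩ * (⟨e, he_p⟩ ^ j)⁻¹ := Subtype.ext (by simp)
      rw [h5, map_mul, map_inv, hx3, hΦej, mul_inv_eq_one]
    have hcomm_eq : ⁅t, x⁆ = ⁅t, x * (e ^ j)⁻¹⁆ := by
      simp only [commutatorElement_def]
      calc t * x * t⁻¹ * x⁻¹
          = t * (x * (e ^ j)⁻¹) * t⁻¹ * (t * e ^ j * t⁻¹) * (e ^ j)⁻¹ * (x * (e ^ j)⁻¹)⁻¹ := by group
        _ = t * (x * (e ^ j)⁻¹) * t⁻¹ * (x * (e ^ j)⁻¹)⁻¹ := by rw [hte j]; group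
    rw [← commutatorElement_def, ← map_commutatorElement, hcomm_eq, map_commutatorElement]
    exact (hcentral _ hγ₁ (π t)).1
  have hS2 : ∀ z ∈ Z, z ∈ ⁅Subgroup.closure ({π t} ∪ (Ahat : Set (SL(2, ℤ) ⧸ K))),
      Subgroup.closure ({π t} ∪ (Ahat : Set (SL(2, ℤ) ⧸ K)))⁆ → z = 1 := fun z hzZ hz ↦
    eq_one_of_mem_of_mem_commutator_closure Z Ahat (π t) hAcomm htA htA' hker hzZ hz
  -- STEP 3: the subgroup `H = {x ∈ Γ(m') : x mod p ∈ ⟨T̄⟩}` and its local condition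
  set X : Subgroup SL(2, ℤ) := (Subgroup.zpowers (red T)).comap red with hX
  set H : Subgroup SL(2, ℤ) := X ⊓ Gamma m' with hH
  have hNH : Gamma (m' * p ^ 2) ≤ H := by
    intro x hx
    refine Subgroup.mem_inf.mpr ⟨?_, hNm' hx⟩
    rw [hX, Subgroup.mem_comap, (Gamma_mem'.mp (hp2p (hNp2 hx)) : red x = 1)]
    exact one_mem _
  have hHL : H.map π ≤ Subgroup.closure ({π t} ∪ (Ahat : Set (SL(2, ℤ) ⧸ K))) := by
    rintro _ ⟨x, hx, rfl⟩
    obtain ⟨hxX, hxm'⟩ := Subgroup.mem_inf.mp hx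
    rw [hX, Subgroup.mem_comap, Subgroup.mem_zpowers_iff] at hxX
    obtain ⟨i, hi⟩ := hxX
    have ha : t ^ (-i) * x ∈ Gamma (m' * p) := by
      refine hmemA _ (mul_mem (zpow_mem htm' _) hxm') ?_
      rw [Gamma_mem', map_mul, map_zpow, ← hred, htp, ← hi, ← zpow_add, neg_add_cancel, zpow_zero]
    have hxeq : π x = (π t) ^ i * π (t ^ (-i) * x) := by
      rw [← map_zpow, ← map_mul]; congr 1; group
    rw [hxeq]
    exact mul_mem (zpow_mem (Subgroup.subset_closure (Set.mem_union_left _ (Set.mem_singleton _))) i)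
      (Subgroup.subset_closure (Set.mem_union_right _ (hπA _ ha)))
  have hloc : ∀ (y : SL(2, ℤ)) (hy : y ∈ Gamma (m' * p ^ 2)),
      y ∈ ⁅H, H⁆ ⊔ θ.ker.map (Gamma (m' * p ^ 2)).subtype → θ ⟨y, hy⟩ = 1 := by
    intro y hy hyc
    have hπy : π y ∈ Z := Subgroup.mem_map_of_mem π hy
    have h3 : y ∈ ⁅H, H⁆ ⊔ K := hyc
    rw [Subgroup.mem_sup_of_normal_right] at h3
    obtain ⟨u, hu, v, hv, rfl⟩ := h3
    have hv1 : π v = 1 := by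
      rw [hπ, QuotientGroup.mk'_apply]; exact (QuotientGroup.eq_one_iff v).mpr hv
    have hπu : π (u * v) ∈ ⁅Subgroup.closure ({π t} ∪ (Ahat : Set (SL(2, ℤ) ⧸ K))),
        Subgroup.closure ({π t} ∪ (Ahat : Set (SL(2, ℤ) ⧸ K)))⁆ := by
      rw [map_mul, hv1, mul_one]
      have h4 : π u ∈ (⁅H, H⁆).map π := ⟨u, hu, rfl⟩
      rw [Subgroup.map_commutator] at h4
      exact Subgroup.commutator_mono hHL hHL h4
    have hone := hS2 _ hπy hπu
    have hyK : u * v ∈ K := by rwa [← QuotientGroup.ker_mk' K, MonoidHom.mem_ker]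
    obtain ⟨_, h⟩ := (mem_ker_map_subtype_iff θ).mp hyK
    exact h
  -- STEP 4: relative index `(p+1)(p-1)` and transfer
  have htop : (Gamma m').map red = ⊤ := by
    rw [eq_top_iff]
    intro s _
    obtain ⟨d, hd, hds⟩ := exists_mem_Gamma_map_eq hmm s
    exact ⟨d, hd, hds⟩
  have hidx : H.relIndex (Gamma m') = (p + 1) * (p - 1) := by
    rw [hH, Subgroup.inf_relIndex_right, hX, Subgroup.relIndex_comap, htop, Subgroup.relIndex_top_right, hred]
    exact index_zpowers_map_T hp
  have cop_succ : Nat.Coprime p (p + 1) := Nat.coprime_self_add_right.mpr (Nat.coprime_one_right p)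
  have cop_pred : Nat.Coprime p (p - 1) := by
    have h : p = 1 + (p - 1) := (Nat.add_sub_cancel' hp.one_le).symm
    conv_lhs => rw [h]
    exact Nat.coprime_add_self_left.mpr (Nat.coprime_one_left _)
  have hidx0 : H.relIndex (Gamma m') ≠ 0 := by
    rw [hidx]
    exact Nat.mul_ne_zero (Nat.succ_ne_zero p) (Nat.sub_ne_zero_of_lt hp.one_lt)
  have hcop : (p ^ a).Coprime (H.relIndex (Gamma m')) := by
    rw [hidx]
    exact Nat.Coprime.pow_left _ (Nat.Coprime.mul_right cop_succ cop_pred)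
  exact local_of_local_of_relIndex_coprime θ hθ H (Gamma m') hNH inf_le_right he hidx0 hcop hloc
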